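import Literature.Geometry.PolyhedralFans.SectionMonoid
import HarnessLib

/-!
# The tight cone and the blow-up chart monoid of a section monoid — Kato 1994 (10.4)

`Literature/Geometry/PolyhedralFans/SectionMonoidTight.lean`. Continuation of `SectionMonoid.lean`
(the section monoid `Γ` of strictly convex cone-wise linear data `m` on a fan `Δ`, [KKMS] I §2 /
Kato 1994 (10.4)):

* `exists_tight_cone` — **the tight cone**: for `g ∈ Γ_k`, `k ≥ 1`, there is a cone `τ ∈ Δ` with
  `{x ∈ ℤⁿ : x + jg ∈ Γ_{jk} for some j} = τ^∨ ∩ ℤⁿ` (strict convexity forces all generators on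
  which `⟨g, ·⟩ = k·h` into one cone);
* `closure_eq_setOf_exists` — at a Veronese degree `k` with `Γ_k = s + Γ₀`, for `g ∈ s` the monoid
  `⟨Γ₀ ∪ (s − g)⟩` (the chart monoid of the blow-up of the monoid ideal `Γ_k` at `g`) is that set.

References: [KempfEtAl1973] Ch. I §2 Thm. 11; [Kato1994] K. Kato, Toric singularities,
Amer. J. Math. 116 (1994), (10.4); [Fulton1993Toric] §1.2.
-/

noncomputable section

namespace Literature.Geometry.PolyhedralFans

open PointedCone Literature.Combinatorics.Optimization.HilbertBasis

variable {n : ℕ} (Δ : Fan ℚ (Fin n → ℚ)) (m : PointedCone ℚ (Fin n → ℚ) → (Fin n → ℚ))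

/-! ### The tight cone of an element of positive degree -/

/-- The hyperplane cone `{v : ⟨w, v⟩ = 0}`. [folklore] -/
def perpCone (w : Fin n → ℚ) : PointedCone ℚ (Fin n → ℚ) where
  carrier := {v | w ⬝ᵥ v = 0}
  zero_mem' := by simp
  add_mem' := by
    intro a b ha hb
    simp only [Set.mem_setOf_eq, dotProduct_add] at *
    rw [ha, hb, add_zero]
  smul_mem' := by
    intro c v hv
    simp only [Set.mem_setOf_eq] at *
    rw [show (c • v : Fin n → ℚ) = (c : ℚ) • v from rfl, dotProduct_smul, hv, smul_zero]

/-- Membership in `perpCone`. [cite: Fulton1993Toric, §1.2 p. 9] -/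
@[simp] theorem mem_perpCone {w v : Fin n → ℚ} : v ∈ perpCone w ↔ w ⬝ᵥ v = 0 := Iff.rfl

/-- The zero set of a functional non-negative on a cone is a face. [cite: Fulton1993Toric, §1.2 p. 9] -/
theorem isFaceOf_inf_perpCone {ρ : PointedCone ℚ (Fin n → ℚ)} {w : Fin n → ℚ}
    (hw : ∀ v ∈ ρ, 0 ≤ w ⬝ᵥ v) : (ρ ⊓ perpCone w).IsFaceOf ρ := by
  refine IsFaceOf.of_mem_of_add_mem_left inf_le_left fun {x y} hx hy hxy => ?_
  refine Submodule.mem_inf.2 ⟨hx, ?_⟩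
  have h1 := (Submodule.mem_inf.1 hxy).2
  rw [mem_perpCone, dotProduct_add] at h1
  rw [mem_perpCone]
  linarith [hw x hx, hw y hy]

section Tight

variable (gens : PointedCone ℚ (Fin n → ℚ) → Finset (Fin n → ℚ))
  (hgens : ∀ ρ ∈ Δ.cones, PointedCone.hull ℚ (gens ρ : Set (Fin n → ℚ)) = ρ)

include hgens in
/-- Generators lie in their cone. [folklore] -/
private theorem gens_mem {ρ : PointedCone ℚ (Fin n → ℚ)} (hρ : ρ ∈ Δ.cones) {s : Fin n → ℚ} (hs : s ∈ gens ρ) :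
    s ∈ ρ := by
  rw [← hgens ρ hρ]; exact PointedCone.subset_hull hs

/-- Finite sums of elements of the support stay in the support when it is additively closed.
[folklore] -/
private theorem sum_mem_support {ι : Type*} (t : Finset ι) (f : ι → Fin n → ℚ)
    (hadd : ∀ x ∈ Δ.support, ∀ y ∈ Δ.support, x + y ∈ Δ.support) (h0 : (0 : Fin n → ℚ) ∈ Δ.support)
    (hf : ∀ i ∈ t, f i ∈ Δ.support) : ∑ i ∈ t, f i ∈ Δ.support := by
  classical
  induction t using Finset.induction_on with
  | empty => simpa using h0
  | @insert i t hi ih =>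
    rw [Finset.sum_insert hi]
    exact hadd _ (hf i (Finset.mem_insert_self i t)) _
      (ih fun j hj => hf j (Finset.mem_insert_of_mem hj))

include hgens in
/-- **The tight cone.** Let `m` be strictly convex cone-wise linear data on a fan `Δ` with additively
closed support, and `g ∈ Γ_k`, `k ≥ 1`. Then there is a cone `τ ∈ Δ` (the locus where
`⟨g, ·⟩ = k·h`) such that `x + j·g ∈ Γ_{jk}` for some `j` iff `⟨x, ·⟩ ≥ 0` on `τ`.
[cite: Kato1994, (10.4)] [cite: KempfEtAl1973, I §2 Thm. 11] -/
theorem exists_tight_cone (hm : Δ.IsStrictSupport m)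
    (hadd : ∀ x ∈ Δ.support, ∀ y ∈ Δ.support, x + y ∈ Δ.support) (hne : Δ.cones.Nonempty)
    {g : Fin n → ℤ} {k : ℕ} (hk : 0 < k) (hg : g ∈ piece Δ m k) :
    ∃ τ ∈ Δ.cones, ∀ x : Fin n → ℤ,
      (∃ j : ℕ, x + j • g ∈ piece Δ m (j * k)) ↔ ∀ v ∈ τ, 0 ≤ toRat x ⬝ᵥ v := by
  classical
  -- the slack `δ ρ s = ⟨g − k m_ρ, s⟩ ≥ 0`
  set δ : PointedCone ℚ (Fin n → ℚ) → (Fin n → ℚ) → ℚ := fun ρ s => (toRat g - (k : ℚ) • m ρ) ⬝ᵥ s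
    with hδ
  have hg' := (mem_secMonoid_iff Δ m).1 hg
  have hδnn : ∀ ρ ∈ Δ.cones, ∀ v ∈ ρ, 0 ≤ δ ρ v := fun ρ hρ v hv => hg' ρ hρ v hv
  -- the sum of the tight generators and a cone containing it
  have h0 : (0 : Fin n → ℚ) ∈ Δ.support := by
    obtain ⟨ρ, hρ⟩ := hne
    exact Fan.mem_support.2 ⟨ρ, hρ, ρ.zero_mem⟩
  set w₀ : Fin n → ℚ := ∑ ρ ∈ Δ.finite.toFinset, ∑ s ∈ (gens ρ).filter (fun s => δ ρ s = 0), s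
    with hw₀
  have hw₀supp : w₀ ∈ Δ.support := by
    refine sum_mem_support Δ _ _ hadd h0 fun ρ hρ => sum_mem_support Δ _ _ hadd h0 fun s hs => ?_
    have hρ' := Δ.finite.mem_toFinset.1 hρ
    exact Fan.mem_support.2 ⟨ρ, hρ', gens_mem Δ gens hgens hρ' (Finset.mem_filter.1 hs).1⟩
  obtain ⟨ρ₀, hρ₀, hw₀ρ₀⟩ := Fan.mem_support.1 hw₀supp
  -- every tight generator lies in `ρ₀`
  have htight : ∀ ρ ∈ Δ.cones, ∀ s ∈ gens ρ, δ ρ s = 0 → s ∈ ρ₀ ∧ δ ρ₀ s = 0 := by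
    -- `δ ρ₀ s ≤ 0` for tight `(ρ, s)`, and their sum `δ ρ₀ w₀ ≥ 0`
    have hle : ∀ ρ ∈ Δ.cones, ∀ s ∈ gens ρ, δ ρ s = 0 → δ ρ₀ s ≤ 0 := by
      intro ρ hρ s hs h
      have hsρ := gens_mem Δ gens hgens hρ hs
      have h1 : m ρ ⬝ᵥ s ≤ m ρ₀ ⬝ᵥ s := (hm hρ₀ hρ hsρ).1
      have h2 : δ ρ₀ s = δ ρ s + (k : ℚ) * (m ρ ⬝ᵥ s - m ρ₀ ⬝ᵥ s) := by
        simp only [hδ, sub_dotProduct, smul_dotProduct, smul_eq_mul]; ring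
      rw [h2, h, zero_add]
      exact mul_nonpos_of_nonneg_of_nonpos (Nat.cast_nonneg k) (by linarith)
    have hsum : δ ρ₀ w₀ = ∑ ρ ∈ Δ.finite.toFinset, ∑ s ∈ (gens ρ).filter (fun s => δ ρ s = 0), δ ρ₀ s := by
      simp only [hδ, hw₀, dotProduct_sum]
    have hsum0 : ∑ ρ ∈ Δ.finite.toFinset, ∑ s ∈ (gens ρ).filter (fun s => δ ρ s = 0), δ ρ₀ s = 0 := by
      apply le_antisymm
      · exact Finset.sum_nonpos fun ρ hρ => Finset.sum_nonpos fun s hs =>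
          hle ρ (Δ.finite.mem_toFinset.1 hρ) s (Finset.mem_filter.1 hs).1 (Finset.mem_filter.1 hs).2
      · rw [← hsum]; exact hδnn ρ₀ hρ₀ w₀ hw₀ρ₀
    intro ρ hρ s hs h
    have hρ' := Δ.finite.mem_toFinset.2 hρ
    have hs' : s ∈ (gens ρ).filter (fun s => δ ρ s = 0) := Finset.mem_filter.2 ⟨hs, h⟩
    have hterm : δ ρ₀ s = 0 := by
      have hinner : ∑ s ∈ (gens ρ).filter (fun s => δ ρ s = 0), δ ρ₀ s = 0 := by
        refine (Finset.sum_eq_zero_iff_of_nonpos fun ρ' hρ'' => Finset.sum_nonpos fun s hs =>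
          hle ρ' (Δ.finite.mem_toFinset.1 hρ'') s (Finset.mem_filter.1 hs).1 (Finset.mem_filter.1 hs).2).1
          hsum0 ρ hρ'
      exact (Finset.sum_eq_zero_iff_of_nonpos fun s hs =>
        hle ρ hρ s (Finset.mem_filter.1 hs).1 (Finset.mem_filter.1 hs).2).1 hinner s hs'
    have hsρ := gens_mem Δ gens hgens hρ hs
    have heq : m ρ ⬝ᵥ s = m ρ₀ ⬝ᵥ s := by
      have h2 : δ ρ₀ s = δ ρ s + (k : ℚ) * (m ρ ⬝ᵥ s - m ρ₀ ⬝ᵥ s) := by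
        simp only [hδ, sub_dotProduct, smul_dotProduct, smul_eq_mul]; ring
      rw [h, hterm, zero_add] at h2
      have hk' : (k : ℚ) ≠ 0 := by exact_mod_cast hk.ne'
      have := (mul_eq_zero.1 h2.symm).resolve_left hk'
      linarith
    exact ⟨(hm hρ₀ hρ hsρ).2 heq, hterm⟩
  -- the tight cone
  refine ⟨ρ₀ ⊓ perpCone (toRat g - (k : ℚ) • m ρ₀), Δ.face_mem hρ₀ (isFaceOf_inf_perpCone (hδnn ρ₀ hρ₀)),
    fun x => ⟨?_, ?_⟩⟩
  · -- `x + jg ∈ Γ_{jk}` ⇒ `⟨x, v⟩ ≥ 0` on the tight cone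
    rintro ⟨j, hj⟩ v hv
    obtain ⟨hvρ, hv0⟩ := Submodule.mem_inf.1 hv
    rw [mem_perpCone] at hv0
    have h1 := (mem_secMonoid_iff Δ m).1 hj ρ₀ hρ₀ v hvρ
    simp only at h1
    rw [toRat_add, toRat_nsmul] at h1
    have h2 : (toRat x + (j : ℚ) • toRat g - ((j * k : ℕ) : ℚ) • m ρ₀) ⬝ᵥ v =
        toRat x ⬝ᵥ v + (j : ℚ) * ((toRat g - (k : ℚ) • m ρ₀) ⬝ᵥ v) := by
      simp only [sub_dotProduct, add_dotProduct, smul_dotProduct, smul_eq_mul, Nat.cast_mul]; ring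
    rw [h2, hv0, mul_zero, add_zero] at h1
    exact h1
  · -- `⟨x, v⟩ ≥ 0` on the tight cone ⇒ `x + jg ∈ Γ_{jk}` for large `j`
    intro hx
    -- choose `j` large on the non-tight generators
    have hex : ∀ ρ ∈ Δ.cones, ∀ s ∈ gens ρ, ∃ j₀ : ℕ, ∀ j : ℕ, j₀ ≤ j →
        0 ≤ toRat x ⬝ᵥ s + (j : ℚ) * δ ρ s := by
      intro ρ hρ s hs
      by_cases h : δ ρ s = 0
      · obtain ⟨hs₀, hδ₀⟩ := htight ρ hρ s hs h
        refine ⟨0, fun j _ => ?_⟩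
        rw [h, mul_zero, add_zero]
        exact hx s (Submodule.mem_inf.2 ⟨hs₀, by rw [mem_perpCone]; exact hδ₀⟩)
      · have hpos : 0 < δ ρ s := lt_of_le_of_ne (hδnn ρ hρ s (gens_mem Δ gens hgens hρ hs)) (Ne.symm h)
        obtain ⟨j₀, hj₀⟩ := exists_nat_ge (-(toRat x ⬝ᵥ s) / δ ρ s)
        refine ⟨j₀, fun j hj => ?_⟩
        have hj' : -(toRat x ⬝ᵥ s) / δ ρ s ≤ j := hj₀.trans (by exact_mod_cast hj)
        rw [div_le_iff₀ hpos] at hj'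
        linarith
    choose! J hJ using hex
    set j : ℕ := ∑ ρ ∈ Δ.finite.toFinset, ∑ s ∈ gens ρ, J ρ s with hj
    have hJle : ∀ ρ ∈ Δ.cones, ∀ s ∈ gens ρ, J ρ s ≤ j := by
      intro ρ hρ s hs
      rw [hj]
      exact (Finset.single_le_sum (f := fun s => J ρ s) (fun _ _ => Nat.zero_le _) hs).trans
        (Finset.single_le_sum (f := fun ρ => ∑ s ∈ gens ρ, J ρ s) (fun _ _ => Nat.zero_le _)
          (Δ.finite.mem_toFinset.2 hρ))
    refine ⟨j, (mem_secMonoid_iff_gens Δ m gens hgens).2 fun ρ hρ s hs => ?_⟩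
    simp only
    rw [toRat_add, toRat_nsmul]
    have h2 : (toRat x + (j : ℚ) • toRat g - ((j * k : ℕ) : ℚ) • m ρ) ⬝ᵥ s =
        toRat x ⬝ᵥ s + (j : ℚ) * δ ρ s := by
      simp only [hδ, sub_dotProduct, add_dotProduct, smul_dotProduct, smul_eq_mul, Nat.cast_mul]; ring
    rw [h2]
    exact hJ ρ hρ s hs j (hJle ρ hρ s hs)

end Tight

/-! ### The chart monoid at a generator -/

/-- **The chart monoid of the blow-up.** If `Γ_{jk} = Γ_k + ⋯ + Γ_k` (`k` a Veronese degree) and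
`Γ_k = s + Γ₀` with `s ⊆ Γ_k` finite, then for `g ∈ s` the monoid generated by `Γ₀` and `s − g` is
`{x : x + jg ∈ Γ_{jk} for some j}`. [cite: Kato1994, (10.4)] -/
theorem closure_eq_setOf_exists {k : ℕ}
    (hver : ∀ j : ℕ, 0 < j → ∀ u ∈ piece Δ m (j * k),
      ∃ us : Fin j → Fin n → ℤ, (∀ i, us i ∈ piece Δ m k) ∧ u = ∑ i, us i)
    {s : Finset (Fin n → ℤ)} (hsk : ↑s ⊆ piece Δ m k)
    (hsgen : ∀ u ∈ piece Δ m k, ∃ y ∈ s, ∃ z ∈ pieceZero Δ m, u = y + z)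
    {g : Fin n → ℤ} (hg : g ∈ s) :
    (AddSubmonoid.closure ((pieceZero Δ m : Set (Fin n → ℤ)) ∪ (fun y => y - g) '' ↑s) : Set (Fin n → ℤ)) =
      {x | ∃ j : ℕ, x + j • g ∈ piece Δ m (j * k)} := by
  have hgk : g ∈ piece Δ m k := hsk hg
  -- the right-hand side is a submonoid
  have hR0 : (0 : Fin n → ℤ) ∈ {x : Fin n → ℤ | ∃ j : ℕ, x + j • g ∈ piece Δ m (j * k)} :=
    ⟨0, by rw [zero_smul, add_zero, zero_mul]; exact (pieceZero Δ m).zero_mem⟩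
  have hRadd : ∀ x ∈ {x : Fin n → ℤ | ∃ j : ℕ, x + j • g ∈ piece Δ m (j * k)},
      ∀ y ∈ {x : Fin n → ℤ | ∃ j : ℕ, x + j • g ∈ piece Δ m (j * k)},
      x + y ∈ {x : Fin n → ℤ | ∃ j : ℕ, x + j • g ∈ piece Δ m (j * k)} := by
    rintro x ⟨i, hi⟩ y ⟨j, hj⟩
    refine ⟨i + j, ?_⟩
    have := add_mem_piece Δ m hi hj
    have e : x + i • g + (y + j • g) = x + y + (i + j) • g := by rw [add_smul]; abel
    rwa [e, show i * k + j * k = (i + j) * k by ring] at this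
  apply le_antisymm
  · -- generators lie in the right-hand side
    change AddSubmonoid.closure _ ≤ AddSubmonoid.mk ⟨{x | ∃ j : ℕ, x + j • g ∈ piece Δ m (j * k)},
      fun {x y} hx hy => hRadd x hx y hy⟩ hR0
    rw [AddSubmonoid.closure_le]
    rintro x (hx | ⟨y, hy, rfl⟩)
    · refine ⟨0, ?_⟩
      simpa using (show x ∈ piece Δ m 0 from hx)
    · refine ⟨1, ?_⟩
      simpa using hsk hy
  · rintro x ⟨j, hj⟩
    by_cases hj0 : j = 0
    · subst hj0
      simp only [zero_smul, add_zero, zero_mul] at hj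
      exact AddSubmonoid.subset_closure (Or.inl hj)
    obtain ⟨us, hus, hsum⟩ := hver j (Nat.pos_of_ne_zero hj0) _ hj
    -- write each `us i = y i + z i`
    choose y hy z hz hyz using fun i => hsgen (us i) (hus i)
    have hx : x = ∑ i, ((y i - g) + z i) := by
      have h1 : x = (∑ i, us i) - j • g := by rw [← hsum]; abel
      rw [h1, Finset.sum_congr rfl fun i _ => hyz i]
      simp only [Finset.sum_add_distrib, Finset.sum_sub_distrib, Finset.sum_const, Finset.card_univ,
        Fintype.card_fin]
      abel
    rw [hx]
    refine AddSubmonoid.sum_mem _ fun i _ => AddSubmonoid.add_mem _ ?_ ?_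
    · exact AddSubmonoid.subset_closure (Or.inr ⟨y i, hy i, rfl⟩)
    · exact AddSubmonoid.subset_closure (Or.inl (hz i))

end Literature.Geometry.PolyhedralFans
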